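import Literature.Analysis.FluidPDE.NSCriticalClosureBesovSingleLeaf
import Literature.Analysis.FluidPDE.NSClassicalPathSpace
import HarnessLib

/-!
# The critical Besov continuation criterion from GKP's Theorem 1 over GKP's own path space

Analysis/FluidPDE assembly file (proofs only: no definition, no named fact, no statement of the
tree is changed) for the named fact
`Literature.Analysis.FluidPDE.hasSmoothExtensionPast_of_eHomBesovNorm_bounded`
(`NSCriticalClosure.lean`; Gallagher–Koch–Planchon 2016, Thm. 1, contrapositive for classical
Leray–Hopf solutions from rapidly decaying data).

## Why

`NSCriticalClosureBesovSingleLeaf.lean` rests the fact on ONE named fact of blow-up-criterion type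
— `gkp_besov_blowup` (GKP Thm. 1), GKP Props. 2.1–2.3, `albritton_besov_blowup`, … — each
quantifying over the tree's class `IsBesovMildSolutionOn` / `IsMaximalBesovMildSolution`. The
audits of the GKP seats (`GKPRegularityPersistence.lean`, `GKPCriticalElementsPathSpace.lean`,
`GKPCompactnessPathSpace.lean`, `GKPRigidityProofs.lean`) show that the printed statements concern
`NS(u₀)`, the solution in GKP's path space `𝓛^{1:∞}_{p}[T' < T]` (`MemGKPPathSpace`), and that
transporting them to the tree's wider class needs an unprinted (and, after Fujii 2026, doubtful)
identification `hId`. For the continuation criterion this identification is **not needed**: the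
classical solution the fact is about lies in the path space
(`memGKPPathSpace_of_classical`, `NSClassicalPathSpace.lean`), and its maximality may be taken in
GKP's own sense (no extension in class ∩ path space). This file records the criterion as the
consequence of **GKP's Theorem 1 over GKP's path space** alone:

* `hasSmoothExtensionPast_of_eHomBesovNorm_bounded_of_gkpThm1_pathSpace (hG) : _` (and the
  `sup` form `…_pathSpace_sup`, a weaker hypothesis), where `hG` is Theorem 1 for the exponents `p = q = 3·2^k - 2` (`IsGKPExponent`, the class GKP actually treat,
  §2.1 p. 6) in the path-space rendering of the GKP seats: *a Besov mild solution `(u, U)` on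
  `[0, T)`, `0 < T`, of the class `(s_p, p, p)` lying in `𝓛^{1:∞}_p[T' < T]` which admits no
  extension to a longer interval inside that class has `limsup_{t ↑ T} ‖U t‖_{Ḃ^{s_p}_{p,p}} = ∞`*
  (GKP 2016, Thm. 1 with Rem. 1.3 and (1.9): `T = T*(u₀)`, the maximal time in `𝓛^{1:∞}`).

Everything else is a theorem of the tree: Tao 2013 (Cor. 11.1, Cor. 4.3, Thm. 5.4:
`tao2011_hasBoundedSobolevNormsOn_holds`, `tao2011_isMildNSSolutionOn_of_memSobolevX_holds`,
`tao2011_smooth_local_existence_holds`), the Littlewood–Paley facts, the Besov embedding, the KNSS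
smoothing of bounded Besov mild extensions (`knss_classical_of_bounded_isBesovMildSolutionOn_of_local`
with `knss2009_local_smoothing_holds`), and the new path-space membership. The proof is that of
`hasSmoothExtensionPast_of_eHomBesovNorm_bounded_of_gkpExponent_knss`
(`NSCriticalClosureBesovExponent.lean`) with the extra clause: pass to a GKP exponent
`p' ≥ max(r, q)` by the embedding (1.1); the classical solution is a Besov mild solution of the
class `(s_{p'}, p', p')` (`isBesovMildSolutionOn_of_classical`) lying in `𝓛^{1:∞}_{p'}[T' < T]`
(`memGKPPathSpace_of_classical`); if it had no smooth extension past `T` it would be maximal in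
GKP's sense (an extension in class ∩ path space is in particular a class extension, bounded near
`T` by Kato's weight, hence — KNSS — a classical extension,
`hasSmoothExtensionPast_of_isBesovMildSolutionOn_extension_of_bounded`), so `hG` would give
`limsup = ∞`, against the bounded critical norm.

## Mathlib / tree search

Tree (2026-08-15): `memGKPPathSpace_of_classical` (`NSClassicalPathSpace`), the exponent-class
tools `exists_isGKPExponent_ge`, `exists_eHomBesovNorm_critical_le`, `biSup_le_const_mul_biSup`,
`limsup_nhdsLT_le_biSup_Ico`, `isBesovMildSolutionOn_of_classical`, `exists_forall_norm_le_of_tao2011`,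
`hasSmoothExtensionPast_of_isBesovMildSolutionOn_extension_of_bounded`
(`NSCriticalClosureBesov*`, `GKPCriticalElements`), the discharges listed above. No path-space form
of the assembly existed (`lean search 'pathSpace' --decl`: the GKP seats' `…_of_pathSpace`
reductions only). Mathlib: no Navier–Stokes theory.

## References

* I. Gallagher, G. S. Koch, F. Planchon, *Blow-up of critical Besov norms at a potential
  Navier–Stokes singularity*, Comm. Math. Phys. 343 (2016) 39–82 = arXiv:1407.4156: Thm. 1 (p. 5),
  Rem. 1.3, (1.5), (1.6), (1.9) (p. 4), §2.1 (p. 6). [GKP2016]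
* M. Fujii, *Sharp non-uniqueness for the Navier–Stokes equations in scaling critical spaces*,
  arXiv:2602.19846 (2026), Thm. 1.2 (as cited in `GKPRegularityPersistence.lean`).
-/

noncomputable section

open MeasureTheory TemperedDistribution Set Function Filter
open _root_.Topology
open scoped SchwartzMap ENNReal NNReal

namespace Literature.Analysis.FluidPDE

/-- **The critical Besov continuation criterion from GKP's Theorem 1 over GKP's path space, `sup`
form.** Hypothesis `hG` (not asserted): Gallagher–Koch–Planchon 2016, Thm. 1 ("`T*(u₀) < ∞`
implies `sup_{t<T*} ‖NS(u₀)(t)‖ = ∞`", the weaker of the two printed forms), for the exponents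
`p = q = 3·2^k - 2`, `k ≥ 2` (`IsGKPExponent`), rendered over GKP's own class — for `ν > 0`,
`0 < T`, a Besov mild solution `(u, U)` on `[0, T)` of the class `(s_p, p, p)` with
`MemGKPPathSpace p p T U` and no extension `(v, V)` to any `[0, T')`, `T' > T`, which is again a
Besov mild solution of that class lying in `𝓛^{1:∞}_p[T'' < T']` and agrees with `u` a.e. at every
`t ∈ [0, T)` ("`T = T*(u₀)`", the convention of `gkp_exists_criticalElement_of_pathSpace`), has
`sup_{0 ≤ t < T} ‖U t‖_{Ḃ^{s_p}_{p,p}} = ∞`. **Conclusion:**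
`hasSmoothExtensionPast_of_eHomBesovNorm_bounded`. All other inputs of the chain are theorems of the
tree (Tao 2013; KNSS 2009 via `knss2009_local_smoothing_holds`; `memGKPPathSpace_of_classical`).
[cite: GKP2016, Thm. 1 with Rem. 1.3 and §2.1] -/
theorem hasSmoothExtensionPast_of_eHomBesovNorm_bounded_of_gkpThm1_pathSpace_sup
    (hG : ∀ ⦃ν : ℝ⦄, 0 < ν → ∀ ⦃p : ℝ≥0∞⦄ [Fact (1 ≤ p)], IsGKPExponent p → ∀ ⦃T : ℝ⦄, 0 < T →
      ∀ ⦃u : ℝ → EuclideanSpace ℝ (Fin 3) → EuclideanSpace ℝ (Fin 3)⦄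
        ⦃U : ℝ → 𝓢'(EuclideanSpace ℝ (Fin 3), EuclideanSpace ℂ (Fin 3))⦄,
        IsBesovMildSolutionOn (-1 + 3 / p.toReal) p p T ν u U → MemGKPPathSpace p p T U →
        (¬ ∃ T' > T, ∃ (v : ℝ → EuclideanSpace ℝ (Fin 3) → EuclideanSpace ℝ (Fin 3))
            (V : ℝ → 𝓢'(EuclideanSpace ℝ (Fin 3), EuclideanSpace ℂ (Fin 3))),
            (IsBesovMildSolutionOn (-1 + 3 / p.toReal) p p T' ν v V ∧ MemGKPPathSpace p p T' V) ∧
              ∀ t ∈ Ico 0 T, v t =ᵐ[volume] u t) →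
          ⨆ t ∈ Ico 0 T, FunctionSpaces.eHomBesovNorm (-1 + 3 / p.toReal) p p (U t) = ∞) :
    hasSmoothExtensionPast_of_eHomBesovNorm_bounded := by
  intro ν T hν hT u p U r q _ hr₃ hr hq₃ hq hsol hLH h₀ hU hsup
  -- the discharged inputs of the chain
  have h₁ : tao2011_hasBoundedSobolevNormsOn := tao2011_hasBoundedSobolevNormsOn_holds
  have h₂ : tao2011_isMildNSSolutionOn_of_memSobolevX := tao2011_isMildNSSolutionOn_of_memSobolevX_holds
  have hTao : tao2011_smooth_local_existence := tao2011_smooth_local_existence_holds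
  have hK : knss_classical_of_bounded_isBesovMildSolutionOn :=
    knss_classical_of_bounded_isBesovMildSolutionOn_of_local
      (knss2009_local_smoothing_holds (EuclideanSpace ℝ (Fin 3)))
  -- a GKP exponent `p' = 3·2^k - 2 ≥ max(r, q)` and the embedding constant of (1.1)
  obtain ⟨p', hp', hrp', hqp'⟩ := exists_isGKPExponent_ge hr hq
  haveI : Fact (1 ≤ p') := ⟨hp'.one_le⟩
  have hq0 : q ≠ 0 := (lt_trans (by norm_num) hq₃).ne'
  obtain ⟨C, hC⟩ :=
    exists_eHomBesovNorm_critical_le FunctionSpaces.besov_embedding_holds hrp' hq0 hqp'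
  have hp'₂ : 2 ≤ p' := le_trans (by norm_num) hp'.three_lt.le
  -- step 1: `(u, U)` is a Besov mild solution on `[0, T)` in the class `(s_{p'}, p', p')` …
  have hB : IsBesovMildSolutionOn (-1 + 3 / p'.toReal) p' p' T ν u U :=
    isBesovMildSolutionOn_of_classical h₁ h₂ hTao tendsto_lowFreqCutoff_of_memLp_two_holds
      eHomBesovNorm_le_of_sobolev_one_holds hν hT hsol hLH h₀ hU hp'₂ hp'.lt_top hp'₂
  -- … lying in GKP's path space `𝓛^{1:∞}_{p'}[T' < T]`
  have hPath : MemGKPPathSpace p' p' T U :=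
    memGKPPathSpace_of_classical hν hT hsol hLH h₀ hU p' p' hp'₂ hp'.one_le
  -- the critical norm of the class `(s_{p'}, p', p')` is bounded on `[0, T)` by the embedding
  have hsup' : ⨆ t ∈ Ico 0 T, FunctionSpaces.eHomBesovNorm (-1 + 3 / p'.toReal) p' p' (U t) < ∞ :=
    (biSup_le_const_mul_biSup fun t => hC (U t)).trans_lt
      (ENNReal.mul_lt_top ENNReal.coe_lt_top hsup)
  -- step 2: if `u` does not extend smoothly past `T`, then `(u, U)` is maximal in GKP's sense
  have hbdd := exists_forall_norm_le_of_tao2011 h₁ hν hsol hLH h₀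
  by_contra hext
  have hmax : ¬ ∃ T' > T, ∃ (v : ℝ → EuclideanSpace ℝ (Fin 3) → EuclideanSpace ℝ (Fin 3))
      (V : ℝ → 𝓢'(EuclideanSpace ℝ (Fin 3), EuclideanSpace ℂ (Fin 3))),
      (IsBesovMildSolutionOn (-1 + 3 / p'.toReal) p' p' T' ν v V ∧ MemGKPPathSpace p' p' T' V) ∧
        ∀ t ∈ Ico 0 T, v t =ᵐ[volume] u t := by
    rintro ⟨T', hT', v, V, ⟨hv, -⟩, hvu⟩
    exact hext (hasSmoothExtensionPast_of_isBesovMildSolutionOn_extension_of_bounded hK hν hT hT'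
      hsol hbdd hp'.three_lt hp'.lt_top hp'.one_le hp'.lt_top hv hvu)
  -- step 3: GKP Thm. 1 over the path space contradicts the bound
  exact hsup'.ne (hG hν hp' hT hB hPath hmax)

/-- **The critical Besov continuation criterion from GKP's Theorem 1 over GKP's path space,
`limsup` form** (GKP 2016, Thm. 1 as printed: "`limsup_{t → T*} ‖NS(u₀)(t)‖ = ∞`"; same
rendering of "`T = T*(u₀)`" over `MemGKPPathSpace` as in the `sup` form, which it implies since
`limsup_{t ↑ T} ≤ sup_{[0,T)}`, `limsup_nhdsLT_le_biSup_Ico`). [cite: GKP2016, Thm. 1] -/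
theorem hasSmoothExtensionPast_of_eHomBesovNorm_bounded_of_gkpThm1_pathSpace
    (hG : ∀ ⦃ν : ℝ⦄, 0 < ν → ∀ ⦃p : ℝ≥0∞⦄ [Fact (1 ≤ p)], IsGKPExponent p → ∀ ⦃T : ℝ⦄, 0 < T →
      ∀ ⦃u : ℝ → EuclideanSpace ℝ (Fin 3) → EuclideanSpace ℝ (Fin 3)⦄
        ⦃U : ℝ → 𝓢'(EuclideanSpace ℝ (Fin 3), EuclideanSpace ℂ (Fin 3))⦄,
        IsBesovMildSolutionOn (-1 + 3 / p.toReal) p p T ν u U → MemGKPPathSpace p p T U →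
        (¬ ∃ T' > T, ∃ (v : ℝ → EuclideanSpace ℝ (Fin 3) → EuclideanSpace ℝ (Fin 3))
            (V : ℝ → 𝓢'(EuclideanSpace ℝ (Fin 3), EuclideanSpace ℂ (Fin 3))),
            (IsBesovMildSolutionOn (-1 + 3 / p.toReal) p p T' ν v V ∧ MemGKPPathSpace p p T' V) ∧
              ∀ t ∈ Ico 0 T, v t =ᵐ[volume] u t) →
          limsup (fun t => FunctionSpaces.eHomBesovNorm (-1 + 3 / p.toReal) p p (U t))
            (𝓝[<] T) = ∞) :
    hasSmoothExtensionPast_of_eHomBesovNorm_bounded := by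
  refine hasSmoothExtensionPast_of_eHomBesovNorm_bounded_of_gkpThm1_pathSpace_sup
    fun ν hν p _ hp T hT u U hB hPath hmax => ?_
  have hle : limsup (fun t => FunctionSpaces.eHomBesovNorm (-1 + 3 / p.toReal) p p (U t))
      (𝓝[<] T) ≤ ⨆ t ∈ Ico 0 T, FunctionSpaces.eHomBesovNorm (-1 + 3 / p.toReal) p p (U t) :=
    limsup_nhdsLT_le_biSup_Ico hT
  rw [hG hν hp hT hB hPath hmax, top_le_iff] at hle
  exact hle

end Literature.Analysis.FluidPDE

end
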